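import Summits.AtomisticToContinuum.Crystallization.Theorems.DisclinationRationUniformPolytypeStabilityGapPinningCellBounds

/-!
# `UniformPolytypeStability` (stmt-AtomisticToContinuum-15800), line `birth` (v2, cells): stub `stub_gapPinning`, part 5 (levels)

Route `DisclinationRation`, crux `UniformPolytypeStability`, line `birth` (lead prover-line-stmt-AtomisticToContinuum-15800-0).
From one cell to one level of the certificate of `…GapPinningDefs` (namespace `StubGapPinning`):

* list bookkeeping (`pairs`, `cellsGV`, `covers`, `foldr min / max`), so that a covered point `η ∈ [lo, hi]` lies in a
  well-formed cell `(mkGV N e₁, mkGV N e₂)` of the list;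
* level bounds: `c0Of ≤ FNd N 1 a η` (slope floor), `|FNd N c a η| ≤ LOf`, `|FN N 0 a η − FN N 1 a η| ≤ oscOf` on
  `[lo, hi]`, and their mean-value consequences (monotone growth `c₀ (η' − η) ≤ FN η' − FN η`, Lipschitz bound);
* the truncation error `|calG c a η − FN N c a η| ≤ hi · a₁⁻¹³ · tauB N lo` on `[lo, hi]`;
* decoding of `finalCheck P = true` into its conjuncts, positivity of the tail constants, and the bridge from the
  materialised list sums `ellOf / EOf` to `Finset.range` sums (`Multiset.range = ↑(List.range ·)`).

Everything is `[folklore]`; theorem-only file; nothing here closes an item.  `stub_gapPinningAux5` is the registered anchor.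
-/

noncomputable section

namespace Summit.AtomisticToContinuum.Crystallization.Theorems.UniformPolytypeStabilityCells

namespace StubGapPinning

open scoped BigOperators
open Set

/-! ## List bookkeeping -/

/-- Elements of `pairs l` have both components in `l`. [folklore] -/
theorem mem_of_mem_pairs {α : Type*} : ∀ {l : List α} {x : α × α}, x ∈ pairs l → x.1 ∈ l ∧ x.2 ∈ l
  | [], x, h => by simp [pairs] at h
  | [a], x, h => by simp [pairs] at h
  | a :: b :: l, x, h => by
    simp only [pairs, List.mem_cons] at h
    rcases h with rfl | h
    · simp
    · have ih := mem_of_mem_pairs (l := b :: l) h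
      exact ⟨List.mem_cons_of_mem _ ih.1, List.mem_cons_of_mem _ ih.2⟩

/-- A cell of `cellsGV N lo hi n` consists of grid records: `g.i = mkGV N g.i.e`. [folklore] -/
theorem cellsGV_eq {N : ℕ} {lo hi : ℚ} {n : ℕ} {g : GV × GV} (hg : g ∈ cellsGV N lo hi n) :
    g.1 = mkGV N g.1.e ∧ g.2 = mkGV N g.2.e := by
  obtain ⟨h1, h2⟩ := mem_of_mem_pairs hg
  obtain ⟨e1, -, he1⟩ := List.mem_map.1 h1
  obtain ⟨e2, -, he2⟩ := List.mem_map.1 h2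
  rw [← he1, ← he2]
  exact ⟨rfl, rfl⟩

/-- `covers lo hi L` ⇒ every real point of `[lo, hi]` lies in an interval of `L`. [folklore] -/
theorem covers_spec : ∀ {L : List (ℚ × ℚ)} {l₀ r₀ : ℚ}, covers l₀ r₀ L = true →
    ∀ {η : ℝ}, (l₀ : ℝ) ≤ η → η ≤ r₀ → ∃ c ∈ L, ((c.1 : ℚ) : ℝ) ≤ η ∧ η ≤ ((c.2 : ℚ) : ℝ)
  | [], _, _, h, _, _, _ => by simp [covers] at h
  | [c], _, _, h, _, h1, h2 => by
    simp only [covers, decide_eq_true_eq] at h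
    refine ⟨c, List.mem_singleton.2 rfl, ?_, ?_⟩
    · exact le_trans (by exact_mod_cast h.1) h1
    · exact le_trans h2 (by exact_mod_cast h.2)
  | c :: c' :: L, _, _, h, η, h1, h2 => by
    simp only [covers, Bool.and_eq_true, decide_eq_true_eq] at h
    by_cases hη : η ≤ ((c.2 : ℚ) : ℝ)
    · exact ⟨c, List.mem_cons_self, le_trans (by exact_mod_cast h.1) h1, hη⟩
    · obtain ⟨d, hd, hd1, hd2⟩ := covers_spec h.2 (le_of_lt (not_le.1 hη)) h2
      exact ⟨d, List.mem_cons_of_mem _ hd, hd1, hd2⟩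

/-- A `foldr min` is below each value. [folklore] -/
theorem foldr_min_le {β : Type*} (v : β → ℚ) (b : ℚ) : ∀ {l : List β} {x : β}, x ∈ l →
    l.foldr (fun y acc => min (v y) acc) b ≤ v x
  | [], x, h => by simp at h
  | y :: l, x, h => by
    simp only [List.foldr_cons]
    rcases List.mem_cons.1 h with rfl | h
    · exact min_le_left _ _
    · exact (min_le_right _ _).trans (foldr_min_le v b h)

/-- A `foldr max` from `0` is above each value. [folklore] -/
theorem le_foldr_max {β : Type*} (v : β → ℚ) : ∀ {l : List β} {x : β}, x ∈ l →
    v x ≤ l.foldr (fun y acc => max (v y) acc) 0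
  | [], x, h => by simp at h
  | y :: l, x, h => by
    simp only [List.foldr_cons]
    rcases List.mem_cons.1 h with rfl | h
    · exact le_max_left _ _
    · exact (le_foldr_max v h).trans (le_max_right _ _)

/-- A `foldr max` from `0` is nonnegative. [folklore] -/
theorem foldr_max_nonneg {β : Type*} (v : β → ℚ) : ∀ l : List β, 0 ≤ l.foldr (fun y acc => max (v y) acc) 0
  | [] => le_rfl
  | _ :: l => (foldr_max_nonneg v l).trans (le_max_right _ _)

/-! ## A covered point lies in a well-formed cell -/

/-- From coverage and well-formedness: a point of `[lo, hi]` lies in a cell `(mkGV N e₁, mkGV N e₂)` of the list with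
`0 < e₁ ≤ η ≤ e₂`. [folklore] -/
theorem exists_cell {N : ℕ} {lo hi : ℚ} {n : ℕ} (hcov : covers lo hi (cellsQ (cellsGV N lo hi n)) = true)
    (hok : (cellsGV N lo hi n).all cellOK = true) {η : ℝ} (h1 : (lo : ℝ) ≤ η) (h2 : η ≤ hi) :
    ∃ g ∈ cellsGV N lo hi n, ∃ e₁ e₂ : ℚ, g = (mkGV N e₁, mkGV N e₂) ∧ 0 < e₁ ∧ (e₁ : ℝ) ≤ η ∧ η ≤ e₂ := by
  obtain ⟨c, hc, hc1, hc2⟩ := covers_spec hcov h1 h2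
  obtain ⟨g, hg, rfl⟩ := List.mem_map.1 hc
  have hwf := (List.all_eq_true.1 hok) g hg
  simp only [cellOK, decide_eq_true_eq] at hwf
  obtain ⟨hg1, hg2⟩ := cellsGV_eq hg
  refine ⟨g, hg, g.1.e, g.2.e, ?_, hwf.1, hc1, hc2⟩
  rw [← hg1, ← hg2]

/-! ## Level bounds -/

section level

variable {N : ℕ} {lo hi : ℚ} {n : ℕ} (hcov : covers lo hi (cellsQ (cellsGV N lo hi n)) = true)
  (hok : (cellsGV N lo hi n).all cellOK = true) {a : ℝ}
include hcov hok

/-- Points of a covered level interval are positive. [folklore] -/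
theorem pos_of_mem {η : ℝ} (h1 : (lo : ℝ) ≤ η) (h2 : η ≤ hi) : 0 < η := by
  obtain ⟨g, -, e₁, e₂, -, he, h₁, -⟩ := exists_cell hcov hok h1 h2
  exact lt_of_lt_of_le (by exact_mod_cast he) h₁

/-- **Slope level**: `c0Of ia₂ N cs ≤ FNd N 1 a η` on `[lo, hi]` (`0 < a ≤ a₂`). [folklore] -/
theorem c0Of_le_FNd {ia₂ : ℚ} (hia₂ : 0 < (ia₂ : ℝ)) (ha₂ : (ia₂ : ℝ) ≤ a⁻¹)
    (hsl : (cellsGV N lo hi n).all (slopeOK ia₂ N) = true) {η : ℝ} (h1 : (lo : ℝ) ≤ η) (h2 : η ≤ hi) :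
    ((c0Of ia₂ N (cellsGV N lo hi n) : ℚ) : ℝ) ≤ FNd N 1 a η := by
  obtain ⟨g, hg, e₁, e₂, rfl, he, h₁, h₂⟩ := exists_cell hcov hok h1 h2
  have hokg := (List.all_eq_true.1 hsl) _ hg
  refine le_trans ?_ (slopeVal_le_FNd he h₁ h₂ hia₂ ha₂ hokg)
  exact_mod_cast foldr_min_le (slopeVal ia₂ N) 1000 hg

variable (ha : 0 < a) {ia₁ ia₂ : ℚ} (hia₂ : 0 < (ia₂ : ℝ)) (ha₂ : (ia₂ : ℝ) ≤ a⁻¹) (ha₁ : a⁻¹ ≤ ia₁)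
include ha hia₂ ha₂ ha₁

/-- **Lipschitz level**: `|FNd N c a η| ≤ LOf` on `[lo, hi]` for `c ∈ {0,1}`, `a ∈ [a₁, a₂]`. [folklore] -/
theorem abs_FNd_le_LOf {c : ℤ} (hc : c = 0 ∨ c = 1) {η : ℝ} (h1 : (lo : ℝ) ≤ η) (h2 : η ≤ hi) :
    |FNd N c a η| ≤ ((LOf ia₁ ia₂ N (cellsGV N lo hi n) : ℚ) : ℝ) := by
  obtain ⟨g, hg, e₁, e₂, rfl, he, h₁, h₂⟩ := exists_cell hcov hok h1 h2
  refine (abs_FNd_le_lipCell he h₁ h₂ ha hia₂ ha₂ ha₁ hc).trans ?_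
  have h := le_foldr_max (fun g => max (lipCell ia₁ ia₂ N g 0) (lipCell ia₁ ia₂ N g 1)) hg (l := cellsGV N lo hi n)
  rw [LOf]
  rcases hc with rfl | rfl
  · exact_mod_cast (le_max_left _ _).trans h
  · exact_mod_cast (le_max_right _ _).trans h

/-- **Oscillation level**: `|FN N 0 a η − FN N 1 a η| ≤ oscOf` on `[lo, hi]` for `a ∈ [a₁, a₂]`. [folklore] -/
theorem abs_FN_sub_le_oscOf {η : ℝ} (h1 : (lo : ℝ) ≤ η) (h2 : η ≤ hi) :
    |FN N 0 a η - FN N 1 a η| ≤ ((oscOf ia₁ ia₂ N (cellsGV N lo hi n) : ℚ) : ℝ) := by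
  obtain ⟨g, hg, e₁, e₂, rfl, he, h₁, h₂⟩ := exists_cell hcov hok h1 h2
  refine (abs_FN_sub_le_oscCell he h₁ h₂ ha hia₂ ha₂ ha₁).trans ?_
  exact_mod_cast le_foldr_max (oscCell ia₁ ia₂ N) hg (l := cellsGV N lo hi n)

/-- **Lipschitz bound on the level interval** (mean value theorem). [folklore] -/
theorem abs_FN_sub_FN_le {c : ℤ} (hc : c = 0 ∨ c = 1) {η η' : ℝ} (h1 : (lo : ℝ) ≤ η) (h2 : η ≤ hi)
    (h1' : (lo : ℝ) ≤ η') (h2' : η' ≤ hi) :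
    |FN N c a η - FN N c a η'| ≤ ((LOf ia₁ ia₂ N (cellsGV N lo hi n) : ℚ) : ℝ) * |η - η'| := by
  have hS : ∀ x ∈ Icc (lo : ℝ) hi, 0 < x := fun x hx => pos_of_mem hcov hok hx.1 hx.2
  have hb : ∀ x ∈ Icc (lo : ℝ) hi, ‖FNd N c a x‖ ≤ ((LOf ia₁ ia₂ N (cellsGV N lo hi n) : ℚ) : ℝ) := fun x hx => by
    rw [Real.norm_eq_abs]; exact abs_FNd_le_LOf hcov hok ha hia₂ ha₂ ha₁ hc hx.1 hx.2
  have h := Convex.norm_image_sub_le_of_norm_hasDerivWithin_le (FN_hasDerivWithinAt N c a hS) hb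
    (convex_Icc _ _) ⟨h1', h2'⟩ ⟨h1, h2⟩
  simpa only [Real.norm_eq_abs] using h

end level

/-- **Monotone growth on the level-`1` interval** (mean value theorem): `c₀ (η' − η) ≤ FN η' − FN η`. [folklore] -/
theorem c0_mul_sub_le {N : ℕ} {lo hi : ℚ} {n : ℕ} (hcov : covers lo hi (cellsQ (cellsGV N lo hi n)) = true)
    (hok : (cellsGV N lo hi n).all cellOK = true) {a : ℝ} {ia₂ : ℚ} (hia₂ : 0 < (ia₂ : ℝ))
    (ha₂ : (ia₂ : ℝ) ≤ a⁻¹) (hsl : (cellsGV N lo hi n).all (slopeOK ia₂ N) = true) {η η' : ℝ}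
    (h1 : (lo : ℝ) ≤ η) (hle : η ≤ η') (h2' : η' ≤ hi) :
    ((c0Of ia₂ N (cellsGV N lo hi n) : ℚ) : ℝ) * (η' - η) ≤ FN N 1 a η' - FN N 1 a η := by
  have hS : ∀ x ∈ Icc (lo : ℝ) hi, 0 < x := fun x hx => pos_of_mem hcov hok hx.1 hx.2
  have hcont : ContinuousOn (fun y => FN N 1 a y) (Icc (lo : ℝ) hi) :=
    fun x hx => (hasDerivAt_FN N 1 a (hS x hx)).continuousAt.continuousWithinAt
  have hdiff : DifferentiableOn ℝ (fun y => FN N 1 a y) (interior (Icc (lo : ℝ) hi)) :=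
    fun x hx => (hasDerivAt_FN N 1 a (hS x (interior_subset hx))).differentiableAt.differentiableWithinAt
  have hge : ∀ x ∈ interior (Icc (lo : ℝ) hi), ((c0Of ia₂ N (cellsGV N lo hi n) : ℚ) : ℝ) ≤
      deriv (fun y => FN N 1 a y) x := by
    intro x hx
    have hx' := interior_subset hx
    rw [(hasDerivAt_FN N 1 a (hS x hx')).deriv]
    exact c0Of_le_FNd hcov hok hia₂ ha₂ hsl hx'.1 hx'.2
  exact (convex_Icc _ _).mul_sub_le_image_sub_of_le_deriv hcont hdiff hge η ⟨h1, hle.trans h2'⟩ η'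
    ⟨h1.trans hle, h2'⟩ hle

/-! ## Truncation error -/

/-- `|calG c a η − FN N c a η| ≤ hi · a₁⁻¹³ · tauB N lo` on `[lo, hi]` (`|c| ≤ 1`, `N ≥ 1`, `0 < a ≤ 1`, `a⁻¹ ≤ ia₁`,
`lo > 0`). [folklore] -/
theorem abs_calG_sub_FN_le {c : ℤ} (hc : |c| ≤ 1) {N : ℕ} (hN : 1 ≤ N) {a : ℝ} (ha : 0 < a) (ha1 : a ≤ 1)
    {ia₁ : ℚ} (hia₁ : a⁻¹ ≤ ia₁) {lo hi : ℚ} (hlo : 0 < lo) {η : ℝ} (h1 : (lo : ℝ) ≤ η) (h2 : η ≤ hi) :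
    |calG c a η - FN N c a η| ≤ (((hi * ia₁ ^ 13 * tauB N lo : ℚ)) : ℝ) := by
  have hlo' : (0 : ℝ) < lo := by exact_mod_cast hlo
  have hη : 0 < η := lt_of_lt_of_le hlo' h1
  have hainv : 1 ≤ a⁻¹ := one_le_inv_iff₀.2 ⟨ha, ha1⟩
  set τ : ℝ := ((tauB N lo : ℚ) : ℝ) with hτ
  have hT : ∀ {k : ℕ}, 4 ≤ k → 0 ≤ Alat k c η - SN k N c η ∧ Alat k c η - SN k N c η ≤ τ := by
    intro k hk
    refine ⟨sub_nonneg.2 (SN_le_Alat hk hc N η), ?_⟩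
    have h := Alat_le_SN_add_tail hk hc hN η
    rw [hτ, tauB_cast]
    have hmono : ((3 / 4 * ((N : ℝ) - 1 / 3) ^ 2 + η ^ 2)⁻¹) ^ 3 ≤ ((3 / 4 * ((N : ℝ) - 1 / 3) ^ 2 + (lo : ℝ) ^ 2)⁻¹) ^ 3 :=
      pow_le_pow_left₀ (inv_nonneg.2 (by positivity)) (inv_anti₀ (by positivity) (by nlinarith)) 3
    have hβ : 0 ≤ 32 * ((N + 1 : ℕ) : ℝ) / (18 * ((N + 1 : ℕ) : ℝ) - 15) :=
      div_nonneg (by positivity) (by push_cast; linarith)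
    nlinarith [mul_le_mul_of_nonneg_left hmono hβ]
  obtain ⟨h4lo, h4hi⟩ := hT (k := 4) le_rfl
  obtain ⟨h7lo, h7hi⟩ := hT (k := 7) (by norm_num)
  have hτ0 : 0 ≤ τ := h4lo.trans h4hi
  have hexp : calG c a η - FN N c a η =
      η * ((a⁻¹) ^ 7 * (Alat 4 c η - SN 4 N c η) - (a⁻¹) ^ 13 * (Alat 7 c η - SN 7 N c η)) := by
    simp only [calG, FN]; ring
  have h713 : (a⁻¹) ^ 7 ≤ (a⁻¹) ^ 13 := pow_le_pow_right₀ hainv (by norm_num)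
  have hia13 : (a⁻¹) ^ 13 ≤ (ia₁ : ℝ) ^ 13 := pow_le_pow_left₀ (by positivity) hia₁ 13
  have hx : 0 ≤ (a⁻¹) ^ 7 * (Alat 4 c η - SN 4 N c η) := by positivity
  have hy : 0 ≤ (a⁻¹) ^ 13 * (Alat 7 c η - SN 7 N c η) := by positivity
  have hxb : (a⁻¹) ^ 7 * (Alat 4 c η - SN 4 N c η) ≤ (a⁻¹) ^ 13 * τ :=
    mul_le_mul h713 h4hi h4lo (by positivity)
  have hyb : (a⁻¹) ^ 13 * (Alat 7 c η - SN 7 N c η) ≤ (a⁻¹) ^ 13 * τ := mul_le_mul_of_nonneg_left h7hi (by positivity)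
  have habs : |(a⁻¹) ^ 7 * (Alat 4 c η - SN 4 N c η) - (a⁻¹) ^ 13 * (Alat 7 c η - SN 7 N c η)| ≤ (a⁻¹) ^ 13 * τ := by
    rw [abs_le]; constructor <;> linarith
  rw [hexp, abs_mul, abs_of_pos hη]
  push_cast
  rw [← hτ]
  calc η * |(a⁻¹) ^ 7 * (Alat 4 c η - SN 4 N c η) - (a⁻¹) ^ 13 * (Alat 7 c η - SN 7 N c η)|
      ≤ (hi : ℝ) * ((a⁻¹) ^ 13 * τ) := mul_le_mul h2 habs (abs_nonneg _) (hη.le.trans h2)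
    _ ≤ (hi : ℝ) * ((ia₁ : ℝ) ^ 13 * τ) :=
        mul_le_mul_of_nonneg_left (mul_le_mul_of_nonneg_right hia13 hτ0) (hη.le.trans h2)
    _ = (hi : ℝ) * (ia₁ : ℝ) ^ 13 * τ := by ring

/-! ## Decoding the certificate -/

/-- Level data membership: `(t, cellsT P t) ∈ tData P` for `2 ≤ t ≤ T`. [folklore] -/
theorem mem_tData (P : Prm) {t : ℕ} (h2 : 2 ≤ t) (hT : t ≤ P.T) : (t, cellsT P t) ∈ tData P := by
  rw [tData, List.mem_map]
  exact ⟨t - 2, List.mem_range.2 (by omega), by rw [Nat.sub_add_cancel h2]⟩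

/-- The conjuncts of `finalCheck P = true`. [folklore] -/
theorem finalCheck_spec {P : Prm} (h : finalCheck P = true) :
    2 ≤ P.T ∧ 1 ≤ P.N1 ∧ covers (It 1).1 (It 1).2 (cellsQ (cells1 P)) = true ∧ (cells1 P).all cellOK = true ∧
    (∀ t, 2 ≤ t → t ≤ P.T →
      1 ≤ P.Nt t ∧ covers (It t).1 (It t).2 (cellsQ (cellsT P t)) = true ∧ (cellsT P t).all cellOK = true) ∧
    covers (47 / 50) 1 P.acells = true ∧ ∀ ac ∈ P.acells, aCellOK P (cells1 P) (tData P) ac = true := by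
  simp only [finalCheck, Bool.and_eq_true, decide_eq_true_eq, List.all_eq_true] at h
  obtain ⟨⟨⟨⟨⟨⟨hT, hN⟩, hcov1⟩, hok1⟩, htd⟩, hcova⟩, hac⟩ := h
  refine ⟨hT, hN, hcov1, List.all_eq_true.2 hok1, fun t h2 ht => ?_, hcova, hac⟩
  have h := htd _ (mem_tData P h2 ht)
  exact ⟨h.1.1, h.1.2, List.all_eq_true.2 h.2⟩

/-- The conjuncts of `aCellOK`. [folklore] -/
theorem aCellOK_spec {P : Prm} {s1 : List (GV × GV)} {td : List (ℕ × List (GV × GV))} {ac : ℚ × ℚ}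
    (h : aCellOK P s1 td ac = true) :
    0 < ac.1 ∧ ac.1 ≤ ac.2 ∧ ac.2 ≤ 1 ∧ s1.all (slopeOK ac.2⁻¹ P.N1) = true ∧
      500 * (2 * tauT ac.1⁻¹ P.N1 1 + EOf P ac.1⁻¹ ac.2⁻¹ td) ≤ c0Of ac.2⁻¹ P.N1 s1 - ellOf P ac.1⁻¹ ac.2⁻¹ td := by
  simp only [aCellOK, Bool.and_eq_true, decide_eq_true_eq] at h
  exact ⟨h.1.1.1, h.1.1.2.1, h.1.1.2.2, h.1.2, h.2⟩

/-! ## Signs of the constants -/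

/-- `tauB ≥ 0`. [folklore] -/
theorem tauB_nonneg (N : ℕ) (e : ℚ) : 0 ≤ tauB N e := by
  rw [tauB, betaC]
  refine div_nonneg (div_nonneg (by positivity) ?_) (by positivity)
  push_cast; linarith

/-- `tauT ≥ 0` for `ia₁ ≥ 0`. [folklore] -/
theorem tauT_nonneg {ia₁ : ℚ} (h : 0 ≤ ia₁) (N t : ℕ) : 0 ≤ tauT ia₁ N t := by
  rw [tauT, It]
  exact mul_nonneg (mul_nonneg (by positivity) (by positivity)) (tauB_nonneg _ _)

/-- `C6 > 0`. [folklore] -/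
theorem C6_pos (T : ℕ) : 0 < C6 T := by
  rw [C6, betaC, It]
  have : (0 : ℚ) < 32 * (4 : ℕ) / (18 * (4 : ℕ) - 15) := by norm_num
  positivity

/-- `tailT > 0` for `ia₁ > 0`, `T ≥ 1`. [folklore] -/
theorem tailT_pos {ia₁ : ℚ} (h : 0 < ia₁) {T : ℕ} (hT : 1 ≤ T) : 0 < tailT ia₁ T := by
  rw [tailT]
  have := C6_pos T
  have hT' : (0 : ℚ) < T := by exact_mod_cast (show 0 < T by omega)
  positivity

/-- `LOf ≥ 0` and `oscOf ≥ 0`. [folklore] -/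
theorem LOf_nonneg (ia₁ ia₂ : ℚ) (N : ℕ) (cs : List (GV × GV)) : 0 ≤ LOf ia₁ ia₂ N cs ∧ 0 ≤ oscOf ia₁ ia₂ N cs :=
  ⟨foldr_max_nonneg _ cs, foldr_max_nonneg _ cs⟩

/-- `ellOf ≥ 0`. [folklore] -/
theorem ellOf_nonneg (P : Prm) (ia₁ ia₂ : ℚ) (td : List (ℕ × List (GV × GV))) : 0 ≤ ellOf P ia₁ ia₂ td := by
  rw [ellOf]
  refine List.sum_nonneg fun x hx => ?_
  obtain ⟨d, -, rfl⟩ := List.mem_map.1 hx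
  exact mul_nonneg (sq_nonneg _) (LOf_nonneg _ _ _ _).1

/-- `EOf ≥ tailT` (all other summands are nonnegative), for `ia₁ ≥ 0`. [folklore] -/
theorem tailT_le_EOf (P : Prm) {ia₁ : ℚ} (h : 0 ≤ ia₁) (ia₂ : ℚ) (td : List (ℕ × List (GV × GV))) :
    tailT ia₁ P.T ≤ EOf P ia₁ ia₂ td := by
  rw [EOf]
  refine le_add_of_nonneg_left (List.sum_nonneg fun x hx => ?_)
  obtain ⟨d, -, rfl⟩ := List.mem_map.1 hx
  exact mul_nonneg (Nat.cast_nonneg _) (add_nonneg (LOf_nonneg _ _ _ _).2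
    (mul_nonneg zero_le_two (tauT_nonneg h _ _)))

/-! ## From the materialised list sums to `Finset.range` sums -/

/-- `ellOf` over the materialised data is `Σ_{i < T-1} (i+2)² L_{i+2}`. [folklore] -/
theorem ellOf_eq (P : Prm) (ia₁ ia₂ : ℚ) :
    ellOf P ia₁ ia₂ (tData P) = ∑ i ∈ Finset.range (P.T - 1), ((i + 2 : ℕ) : ℚ) ^ 2 * LT P ia₁ ia₂ (i + 2) := by
  rw [ellOf, tData, List.map_map, Finset.sum_eq_multiset_sum, Finset.range_val, Multiset.range, Multiset.map_coe,
    Multiset.sum_coe]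
  rfl

/-- `EOf` over the materialised data is `Σ_{i < T-1} (i+2) (osc_{i+2} + 2τ_{i+2}) + tail`. [folklore] -/
theorem EOf_eq (P : Prm) (ia₁ ia₂ : ℚ) :
    EOf P ia₁ ia₂ (tData P) = ∑ i ∈ Finset.range (P.T - 1),
      ((i + 2 : ℕ) : ℚ) * (oscT P ia₁ ia₂ (i + 2) + 2 * tauT ia₁ (P.Nt (i + 2)) (i + 2)) + tailT ia₁ P.T := by
  rw [EOf, tData, List.map_map, Finset.sum_eq_multiset_sum, Finset.range_val, Multiset.range, Multiset.map_coe,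
    Multiset.sum_coe]
  rfl

/-! ## The far tail `Σ_{t > T} t⁻⁴ ≤ 1/(3T³)` -/

/-- `t⁻⁴ ≤ ((t-1)⁻³ − t⁻³)/3` for `t ≥ 2`. [folklore] -/
theorem inv_pow_four_le {t : ℝ} (ht : 2 ≤ t) : (t⁻¹) ^ 4 ≤ (((t - 1)⁻¹) ^ 3 - (t⁻¹) ^ 3) / 3 := by
  have ht0 : t ≠ 0 := by positivity
  have ht1 : t - 1 ≠ 0 := by linarith
  have hpos : 0 < 3 * (t - 1) ^ 3 * t ^ 4 := by
    have : 0 < t - 1 := by linarith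
    positivity
  have key : (((t - 1)⁻¹) ^ 3 - (t⁻¹) ^ 3) / 3 - (t⁻¹) ^ 4 = (6 * t ^ 2 - 8 * t + 3) / (3 * (t - 1) ^ 3 * t ^ 4) := by
    field_simp
    ring
  have hnum : 0 ≤ 6 * t ^ 2 - 8 * t + 3 := by nlinarith
  have : 0 ≤ (6 * t ^ 2 - 8 * t + 3) / (3 * (t - 1) ^ 3 * t ^ 4) := div_nonneg hnum hpos.le
  linarith

/-- `Σ_{j} (j + T + 1)⁻⁴ ≤ 1/(3T³)` (`T ≥ 1`), as a bound on every partial sum and on the `tsum`. [folklore] -/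
theorem tsum_inv_pow_four_le {T : ℕ} (hT : 1 ≤ T) :
    Summable (fun j : ℕ => (((j + T + 1 : ℕ) : ℝ)⁻¹) ^ 4) ∧
      ∑' j : ℕ, (((j + T + 1 : ℕ) : ℝ)⁻¹) ^ 4 ≤ ((T : ℝ)⁻¹) ^ 3 / 3 := by
  have hT' : (1 : ℝ) ≤ T := by exact_mod_cast hT
  have hpart : ∀ n : ℕ, ∑ j ∈ Finset.range n, (((j + T + 1 : ℕ) : ℝ)⁻¹) ^ 4 ≤ ((T : ℝ)⁻¹) ^ 3 / 3 := by
    intro n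
    have htel : ∀ n : ℕ, ∑ j ∈ Finset.range n, (((j + T + 1 : ℕ) : ℝ)⁻¹) ^ 4 ≤
        (((T : ℝ)⁻¹) ^ 3 - (((n + T : ℕ) : ℝ)⁻¹) ^ 3) / 3 := by
      intro n
      induction n with
      | zero => simp
      | succ n ih =>
        rw [Finset.sum_range_succ]
        have h2 : (2 : ℝ) ≤ ((n + T + 1 : ℕ) : ℝ) := by push_cast; linarith
        have h := inv_pow_four_le h2
        have e1 : ((n + T + 1 : ℕ) : ℝ) - 1 = ((n + T : ℕ) : ℝ) := by push_cast; ring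
        have e2 : ((n + 1 + T : ℕ) : ℝ) = ((n + T + 1 : ℕ) : ℝ) := by push_cast; ring
        rw [e1] at h; rw [e2]; linarith
    have hnn : 0 ≤ (((n + T : ℕ) : ℝ)⁻¹) ^ 3 := by positivity
    linarith [htel n]
  have hs : Summable (fun j : ℕ => (((j + T + 1 : ℕ) : ℝ)⁻¹) ^ 4) :=
    summable_of_sum_range_le (fun j => by positivity) hpart
  exact ⟨hs, Real.tsum_le_of_sum_range_le (fun j => by positivity) hpart⟩

end StubGapPinning

/-- Registered anchor `stub_gapPinningAux5` of the levels file of `stub_gapPinning`: the far-tail bound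
`Σ_j (j + T + 1)⁻⁴ ≤ T⁻³/3` (instance `T = 16`). [folklore] -/
theorem stub_gapPinningAux5 : ∑' j : ℕ, (((j + 16 + 1 : ℕ) : ℝ)⁻¹) ^ 4 ≤ ((16 : ℕ) : ℝ)⁻¹ ^ 3 / 3 :=
  (StubGapPinning.tsum_inv_pow_four_le (T := 16) (by norm_num)).2

end Summit.AtomisticToContinuum.Crystallization.Theorems.UniformPolytypeStabilityCells

end
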